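import Mathlib
import Summits.KontsevichZagierPeriods.KontsevichZagierPeriods.Theorems.InverseLandauTateFamilyKernelStubGpCertificate
import Summits.KontsevichZagierPeriods.KontsevichZagierPeriods.Theorems.InverseLandauTateFamilyKernelStubLinMoments

/-!
# Crux `TateFamilyKernel` (stmt-KontsevichZagierPeriods-9130), line `Sketch`:
# stub `stub_eulerDivergence` (wave 12 seed, Euler sector)

The EULER DIVERGENCE IDENTITY, first lemma of the Euler sector of the lead's skeleton of the crux
`Summit.KontsevichZagierPeriods.KontsevichZagierPeriods.Theses.InverseLandau.TateFamilyKernel`.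
Variables: `X 0 = z₁`, `X 1 = z₂` (the square), `X 2 = ϖ` (the parameter); pencil denominator
`Q = 1 − ϖ·T` with `T ∈ ℚ[z₁,z₂]` weighted-homogeneous of degree `d` for the weights `(a, b)`, and a
`ϖ`-free numerator `P₀ ∈ ℚ[z₁,z₂]` weighted-homogeneous of degree `w`.

With `p = P₀(z)`, `t = T(z)`, `q = 1 − ϖt ≠ 0` and `λ = w + a + b`:

  `λ·p/q + d·ϖ·p·t/q² = ∂₁(a z₁ p/q) + ∂₂(b z₂ p/q)`,

the right side written in Griffiths form `Σᵢ [∂ᵢ(Aᵢ)·Q − Aᵢ·∂ᵢQ]/Q²` at the point `(z, ϖ)` with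
`A₀ = a·X₀·P₀`, `A₁ = b·X₁·P₀` (lifted to three variables by `rename Fin.castSucc`).

Proof: the quotient rule gives
`Σᵢ ∂ᵢ(Aᵢ/Q) = (a+b)p/q + (a z₁∂₁p + b z₂∂₂p)/q + pϖ(a z₁∂₁t + b z₂∂₂t)/q²`, and the weighted Euler
identities `a z₁∂₁P₀ + b z₂∂₂P₀ = w·P₀`, `a z₁∂₁T + b z₂∂₂T = d·T`
(Mathlib `MvPolynomial.IsWeightedHomogeneous.sum_weight_X_mul_pderiv`, evaluated at `z` in
`EulerDivergence.euler_aeval`) close it. The polynomial bookkeeping (`pderiv` of the data, the lift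
`rename castSucc` commuting with `∂₀, ∂₁` — `GpCertificate.pderiv_zero_rename`,
`GpCertificate.pderiv_one_rename` — and the evaluation `(rename castSucc F)(z,ϖ) = F(z)` —
`LinMoments.aeval_snoc_rename_castSucc`) is pushed through the algebra map `aeval (Fin.snoc z ϖ)`,
after which the claim is a linear combination of the two Euler identities over a common denominator
`q³`.

References: Kontsevich–Zagier 2001, §1.2 (an elementary algebraic step towards one test class of the
period conjecture). Mathlib plus two landed sibling files; no named fact, no new definition. Helpers
live in the sub-namespace `EulerDivergence`.
-/

noncomputable section

open MvPolynomial

namespace Summit.KontsevichZagierPeriods.InverseLandau.TateFamilyKernel.Descent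

namespace EulerDivergence

/-- **Weighted Euler identity at a real point.** For `F ∈ ℚ[z₁,z₂]` weighted-homogeneous of degree
`n` for the weights `(a, b)`: `a·z₁·(∂₁F)(z) + b·z₂·(∂₂F)(z) = n·F(z)` at every `z ∈ ℝ²`
(Mathlib's `IsWeightedHomogeneous.sum_weight_X_mul_pderiv` pushed through `aeval z`). [folklore] -/
theorem euler_aeval {a b n : ℕ} {F : MvPolynomial (Fin 2) ℚ}
    (hF : F.IsWeightedHomogeneous (![a, b] : Fin 2 → ℕ) n) (z : Fin 2 → ℝ) :
    (a : ℝ) * (z 0 * aeval z (pderiv 0 F)) + (b : ℝ) * (z 1 * aeval z (pderiv 1 F)) =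
      (n : ℝ) * aeval z F := by
  have h := congrArg (aeval z) hF.sum_weight_X_mul_pderiv
  simpa only [map_sum, map_nsmul, Fin.sum_univ_two, Matrix.cons_val_zero, Matrix.cons_val_one,
    nsmul_eq_mul, map_add, map_mul, map_natCast, aeval_X] using h

/-- `∂₀` of the lifted datum `A₀ = a·X₀·P₀`: `∂₀(a X₀ P₀) = a·P₀ + a X₀·∂₀P₀` (Leibniz), with the
lift `rename castSucc` commuted past `∂₀`. [folklore] -/
theorem pderiv_zero_datum (a : ℕ) (P₀ : MvPolynomial (Fin 2) ℚ) :
    pderiv 0 (C (a : ℚ) * X 0 * rename Fin.castSucc P₀ : MvPolynomial (Fin (2 + 1)) ℚ) =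
      C (a : ℚ) * rename Fin.castSucc P₀ +
        C (a : ℚ) * X 0 * rename Fin.castSucc (pderiv 0 P₀) := by
  rw [pderiv_mul, pderiv_C_mul, pderiv_X_self, mul_one, GpCertificate.pderiv_zero_rename]

/-- `∂₁` of the lifted datum `A₁ = b·X₁·P₀`: `∂₁(b X₁ P₀) = b·P₀ + b X₁·∂₁P₀` (Leibniz), with the
lift `rename castSucc` commuted past `∂₁`. [folklore] -/
theorem pderiv_one_datum (b : ℕ) (P₀ : MvPolynomial (Fin 2) ℚ) :
    pderiv 1 (C (b : ℚ) * X 1 * rename Fin.castSucc P₀ : MvPolynomial (Fin (2 + 1)) ℚ) =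
      C (b : ℚ) * rename Fin.castSucc P₀ +
        C (b : ℚ) * X 1 * rename Fin.castSucc (pderiv 1 P₀) := by
  rw [pderiv_mul, pderiv_C_mul, pderiv_X_self, mul_one, GpCertificate.pderiv_one_rename]

/-- `∂₀` of the pencil denominator `Q = 1 − X₂·T`: `∂₀Q = −X₂·∂₀T` (`X₂ = ϖ` is `z₁`-free).
[folklore] -/
theorem pderiv_zero_pencil (T : MvPolynomial (Fin 2) ℚ) :
    pderiv 0 (1 - X 2 * rename Fin.castSucc T : MvPolynomial (Fin (2 + 1)) ℚ) =
      -(X 2 * rename Fin.castSucc (pderiv 0 T)) := by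
  have h20 : (2 : Fin (2 + 1)) ≠ 0 := by decide
  rw [map_sub, pderiv_one, pderiv_mul, pderiv_X_of_ne h20, zero_mul, zero_add,
    GpCertificate.pderiv_zero_rename, zero_sub]

/-- `∂₁` of the pencil denominator `Q = 1 − X₂·T`: `∂₁Q = −X₂·∂₁T` (`X₂ = ϖ` is `z₂`-free).
[folklore] -/
theorem pderiv_one_pencil (T : MvPolynomial (Fin 2) ℚ) :
    pderiv 1 (1 - X 2 * rename Fin.castSucc T : MvPolynomial (Fin (2 + 1)) ℚ) =
      -(X 2 * rename Fin.castSucc (pderiv 1 T)) := by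
  have h21 : (2 : Fin (2 + 1)) ≠ 1 := by decide
  rw [map_sub, pderiv_one, pderiv_mul, pderiv_X_of_ne h21, zero_mul, zero_add,
    GpCertificate.pderiv_one_rename, zero_sub]

/-- The first two coordinates of the point `(z, ϖ) = Fin.snoc z ϖ`: coordinate `0` is `z 0`.
[folklore] -/
theorem snoc_apply_zero (z : Fin 2 → ℝ) (ϖ : ℝ) : (Fin.snoc z ϖ : Fin (2 + 1) → ℝ) 0 = z 0 := rfl

/-- Coordinate `1` of the point `Fin.snoc z ϖ` is `z 1`. [folklore] -/
theorem snoc_apply_one (z : Fin 2 → ℝ) (ϖ : ℝ) : (Fin.snoc z ϖ : Fin (2 + 1) → ℝ) 1 = z 1 := rfl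

/-- Coordinate `2` (the parameter slot) of the point `Fin.snoc z ϖ` is `ϖ`. [folklore] -/
theorem snoc_apply_two (z : Fin 2 → ℝ) (ϖ : ℝ) : (Fin.snoc z ϖ : Fin (2 + 1) → ℝ) 2 = ϖ := rfl

end EulerDivergence

/-- STUB `stub_eulerDivergence` (wave 12 seed — EULER DIVERGENCE IDENTITY, pure algebra). With
`p = P₀(z)`, `t = T(z)`, `q = 1 − ϖt ≠ 0`:
`(w+a+b)·p/q + d·ϖ·p·t/q² = Σ_{i=0,1} [∂ᵢ(Aᵢ)·Q − Aᵢ·∂ᵢQ]/Q²` at `(z, ϖ)`, where `A₀ = a·z₁·P₀`,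
`A₁ = b·z₂·P₀`, `Q = 1 − ϖT` (Griffiths form; variables `X 0, X 1` = square, `X 2 = ϖ`), for `T`,
`P₀` weighted-homogeneous of degrees `d`, `w` with respect to the weights `(a, b)`. Proof: the
quotient rule and the weighted Euler identities `a z₁∂₁P₀ + b z₂∂₂P₀ = w P₀`,
`a z₁∂₁T + b z₂∂₂T = d T` (`MvPolynomial.IsWeightedHomogeneous.sum_weight_X_mul_pderiv`).
[cite: KontsevichZagier2001, §1.2] -/
theorem stub_eulerDivergence (a b d w : ℕ) (T P₀ : MvPolynomial (Fin 2) ℚ)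
    (hT : T.IsWeightedHomogeneous (![a, b] : Fin 2 → ℕ) d) (hP : P₀.IsWeightedHomogeneous (![a, b] : Fin 2 → ℕ) w)
    (z : Fin 2 → ℝ) (ϖ : ℝ) (hq : 1 - ϖ * aeval z T ≠ 0) :
    ((w + a + b : ℕ) : ℝ) * aeval z P₀ / (1 - ϖ * aeval z T) +
        (d : ℝ) * ϖ * aeval z P₀ * aeval z T / (1 - ϖ * aeval z T) ^ 2 =
      aeval (Fin.snoc z ϖ : Fin (2 + 1) → ℝ)
          (pderiv 0 (C (a : ℚ) * X 0 * rename Fin.castSucc P₀) * (1 - X 2 * rename Fin.castSucc T) -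
            C (a : ℚ) * X 0 * rename Fin.castSucc P₀ * pderiv 0 (1 - X 2 * rename Fin.castSucc T)) /
        aeval (Fin.snoc z ϖ : Fin (2 + 1) → ℝ) ((1 - X 2 * rename Fin.castSucc T) ^ 2) +
      aeval (Fin.snoc z ϖ : Fin (2 + 1) → ℝ)
          (pderiv 1 (C (b : ℚ) * X 1 * rename Fin.castSucc P₀) * (1 - X 2 * rename Fin.castSucc T) -
            C (b : ℚ) * X 1 * rename Fin.castSucc P₀ * pderiv 1 (1 - X 2 * rename Fin.castSucc T)) /
        aeval (Fin.snoc z ϖ : Fin (2 + 1) → ℝ) ((1 - X 2 * rename Fin.castSucc T) ^ 2) := by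
  -- the two weighted Euler identities, evaluated at `z`
  have eP := EulerDivergence.euler_aeval hP z
  have eT := EulerDivergence.euler_aeval hT z
  have hq2 : (1 - ϖ * aeval z T) ^ 2 ≠ 0 := pow_ne_zero 2 hq
  -- polynomial level: the quotient-rule data
  rw [EulerDivergence.pderiv_zero_datum, EulerDivergence.pderiv_one_datum,
    EulerDivergence.pderiv_zero_pencil, EulerDivergence.pderiv_one_pencil]
  -- evaluate at `(z, ϖ)`
  simp only [map_sub, map_add, map_mul, map_neg, map_pow, map_one, aeval_X, map_natCast,
    EulerDivergence.snoc_apply_zero, EulerDivergence.snoc_apply_one,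
    EulerDivergence.snoc_apply_two, LinMoments.aeval_snoc_rename_castSucc, Nat.cast_add]
  -- one common denominator `q · q²`, then a linear combination of the Euler identities
  rw [← add_div, div_add_div _ _ hq hq2, div_eq_div_iff (mul_ne_zero hq hq2) hq2]
  linear_combination (-((1 - ϖ * aeval z T) ^ 4)) * eP +
    (-((1 - ϖ * aeval z T) ^ 3 * aeval z P₀ * ϖ)) * eT

end Summit.KontsevichZagierPeriods.InverseLandau.TateFamilyKernel.Descent
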